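import Summits.AtomisticToContinuum.FouriersLaw.Theorems.VanishingNoiseTransferNoisyFourierAbelPairingDefect

/-!
# Gibbs local moments for the Thomson witness, I: uniform one-site moments and Gaussian recursion in one momentum
# (crux `VanishingNoiseTransfer.NoisyFourier`, stmt-AtomisticToContinuum-11977, line `abel-storage-decay`,
# stub B `stub_bulkAbelGKPositivity`; part W4 "GibbsLocalMoments" of lead c7's Thomson-witness project)

`--supports stmt-AtomisticToContinuum-11977` file. Setting: the pinned anharmonic chain `P = pinnedChain ω₂ lam β γ`
(`ω₂ > 0`, `lam, β ≥ 0`, any `γ`), `T > 0`, its Gibbs probability measure `μ_T = P.gibbsMeasure L T`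
(density `ρ = e^{-H/T}` up to `Z`, `H = Σ p²/2 + Φ(q)`: the momenta are i.i.d. `N(0,T)` and independent of the positions).

* Conversion `μ_T` ⟷ `ρ dx` (`integrable_gibbsMeasure_iff`, `integral_gibbsMeasure_le_of_density`) and integrability of
  polynomial observables (`integrable_mul_snd_pow_of_abs_le`, `integrable_abs_fst_pow`, `integrable_abs_snd_pow`, …).
* (M1) `L`-UNIFORM one-site moments: `∫ q_k^{2n} dμ_T ≤ κ_{2n}` (`exists_integral_fst_even_pow_le`, from the tree's one-site
  domination `ChainVariation.pinnedChain_integral_coord_pow_mul_gibbsDensity_le`), `∫ p_k^{2n} dμ_T ≤ (2n)! T^n`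
  (`integral_snd_even_pow_le`), and the absolute moments `∫ |q_k|^m ≤ C_m`, `∫ |p_k|^m ≤ 1 + (2m)! T^m` (`|y|^m ≤ 1 + y^{2m}`).
* (M3) Gaussian recursion with a `p_b`-independent weight `g`: `∫ g p_b^{k+2} dμ_T = T(k+1) ∫ g p_b^k dμ_T`
  (`integral_indep_mul_snd_pow_add_two`, one integration by parts in `p_b` as in
  `HonestZwanzig.pinnedChain_integral_indep_sq_momentum_mul_gibbsDensity`, here against `μ_T` and under integrability
  hypotheses only); hence `∫ g p_b² = T ∫ g`, `∫ g p_b⁴ = 3T² ∫ g` (also in the self-contained form for continuous `g` of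
  polynomial growth, `integral_indep_mul_snd_sq_of_abs_le`), `∫ p_b² = T`, `∫ p_b⁴ = 3T²`, `∫ p_{b'}² p_b² = T²` (`b ≠ b'`).
* Registered helpers `helper_thomsonMomentsOneSite` (M1) and `helper_thomsonMomentsGaussianRecursion` (M3).
Part II (`…ThomsonWitnessMomentsAux1`): uniform local monomial moments (M2) and the three numbers of the project (M4).

References: folklore (Gaussian calculus, one-site domination of the quartic-pinned chain). No definitions;
axioms `propext`, `Classical.choice`, `Quot.sound` only.
-/

noncomputable section

open MeasureTheory
open Literature.MathematicalPhysics.KineticTheory.HeatConduction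
open Summit.AtomisticToContinuum.FouriersLaw.Theorems.ChainVariation
  (pinnedChain_integral_coord_pow_mul_gibbsDensity_le pinnedChain_integral_momentum_even_pow_le
    pinnedChain_abs_momentum_pow_le_all pinnedChain_abs_coord_le)
open Summit.AtomisticToContinuum.FouriersLaw.Theorems.SubdiffusiveBondHeat
  (integral_mul_eq_neg_of_hasLineDerivAt_of_integrable)
open Summit.AtomisticToContinuum.FouriersLaw.Cruxes.SuperadditiveResistance.InsertionToolbox
  (pinnedChain_integrable_of_abs_le)

namespace Summit.AtomisticToContinuum.FouriersLaw.Theorems.NoisyFourier.ThomsonWitness.Moments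

variable {ω₂ lam β : ℝ}

/-! ### Elementary pointwise facts -/

/-- `|y|^m ≤ 1 + y^{2n}` whenever `m ≤ 2n`. [folklore] -/
theorem abs_pow_le_one_add_pow {m n : ℕ} (h : m ≤ 2 * n) (y : ℝ) : |y| ^ m ≤ 1 + y ^ (2 * n) := by
  have h2 : |y| ^ (2 * n) = y ^ (2 * n) := by rw [pow_mul, sq_abs, pow_mul]
  have h0 : 0 ≤ y ^ (2 * n) := by rw [pow_mul]; positivity
  rcases le_or_gt |y| 1 with h1 | h1
  · have : |y| ^ m ≤ 1 := pow_le_one₀ (abs_nonneg y) h1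
    linarith
  · have : |y| ^ m ≤ |y| ^ (2 * n) := pow_le_pow_right₀ h1.le h
    linarith

section Gibbs

variable (hω : 0 < ω₂) (hl : 0 ≤ lam) (hβ : 0 ≤ β) (γ : ℝ) {T : ℝ} (hT : 0 < T)
include hω hl hβ hT

/-! ### Conversion between `μ_T` and the weight `ρ = e^{-H/T}`; integrability of polynomial observables -/

/-- `μ_T`-integrability is Lebesgue integrability against `ρ = e^{-H/T}`. [folklore] -/
theorem integrable_gibbsMeasure_iff (L : ℕ) (f : PhaseSpace L → ℝ) :
    Integrable f ((pinnedChain ω₂ lam β γ).gibbsMeasure L T) ↔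
      Integrable (fun x => f x * (pinnedChain ω₂ lam β γ).gibbsDensity L T x) := by
  rw [OscillatorChain.gibbsMeasure_eq, integrable_tilted_iff (pinnedChain_integrable_gibbsDensity hω hl hβ γ L hT)]
  refine ⟨fun h => h.congr (ae_of_all _ fun x => ?_), fun h => h.congr (ae_of_all _ fun x => ?_)⟩
  · simp only [smul_eq_mul, OscillatorChain.exp_neg_hamiltonian_div]; ring
  · simp only [smul_eq_mul, OscillatorChain.exp_neg_hamiltonian_div]; ring

/-- From a weighted bound to a `μ_T` bound: `∫ f ρ ≤ K ∫ ρ` gives `∫ f dμ_T ≤ K`. [folklore] -/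
theorem integral_gibbsMeasure_le_of_density (L : ℕ) {f : PhaseSpace L → ℝ} {K : ℝ}
    (hle : ∫ x, f x * (pinnedChain ω₂ lam β γ).gibbsDensity L T x ≤
      K * ∫ x, (pinnedChain ω₂ lam β γ).gibbsDensity L T x) :
    ∫ x, f x ∂((pinnedChain ω₂ lam β γ).gibbsMeasure L T) ≤ K := by
  have hZ : 0 < ∫ x, (pinnedChain ω₂ lam β γ).gibbsDensity L T x :=
    integral_exp_pos (pinnedChain_integrable_gibbsDensity hω hl hβ γ L hT)
  rw [(pinnedChain ω₂ lam β γ).integral_gibbsMeasure, inv_mul_le_iff₀ hZ]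
  exact hle.trans_eq (mul_comm _ _)

/-- A continuous observable of polynomial growth in the energy times any power of a momentum is `μ_T`-integrable:
`|g| ≤ C(1+H)^n` gives `g p_b^m ∈ L¹(μ_T)`. [folklore] -/
theorem integrable_mul_snd_pow_of_abs_le (L : ℕ) {g : PhaseSpace L → ℝ} (hg : Continuous g) {C : ℝ} {n : ℕ}
    (hle : ∀ x, |g x| ≤ C * (1 + (pinnedChain ω₂ lam β γ).hamiltonian L x) ^ n) (b : Fin L) (m : ℕ) :
    Integrable (fun x => g x * x.2 b ^ m) ((pinnedChain ω₂ lam β γ).gibbsMeasure L T) := by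
  refine pinnedChain_integrable_of_abs_le hω hl hβ γ L hT (hg.mul (((continuous_apply b).comp continuous_snd).pow m))
    (C := C * 2 ^ m) (k := n + m) fun x => ?_
  have h1 := hle x
  have h2 := pinnedChain_abs_momentum_pow_le_all hω hl hβ γ L x b m
  rw [abs_mul, pow_add]
  calc |g x| * |x.2 b ^ m| ≤ C * (1 + (pinnedChain ω₂ lam β γ).hamiltonian L x) ^ n *
        (2 ^ m * (1 + (pinnedChain ω₂ lam β γ).hamiltonian L x) ^ m) :=
        mul_le_mul h1 h2 (abs_nonneg _) ((abs_nonneg _).trans h1)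
    _ = _ := by ring

/-- `|q_k|^m ∈ L¹(μ_T)`. [folklore] -/
theorem integrable_abs_fst_pow (L : ℕ) (k : Fin L) (m : ℕ) :
    Integrable (fun x : PhaseSpace L => |x.1 k| ^ m) ((pinnedChain ω₂ lam β γ).gibbsMeasure L T) :=
  pinnedChain_integrable_of_abs_le hω hl hβ γ L hT (((continuous_apply k).comp continuous_fst).abs.pow m)
    (C := (1 + ω₂⁻¹) ^ m) (k := m) fun x => by
      rw [abs_pow, abs_abs, ← mul_pow]
      exact pow_le_pow_left₀ (abs_nonneg _) (pinnedChain_abs_coord_le hω hl hβ γ L x k) m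

/-- `q_k^m ∈ L¹(μ_T)`. [folklore] -/
theorem integrable_fst_pow (L : ℕ) (k : Fin L) (m : ℕ) :
    Integrable (fun x : PhaseSpace L => x.1 k ^ m) ((pinnedChain ω₂ lam β γ).gibbsMeasure L T) :=
  pinnedChain_integrable_of_abs_le hω hl hβ γ L hT (((continuous_apply k).comp continuous_fst).pow m)
    (C := (1 + ω₂⁻¹) ^ m) (k := m) fun x => by
      rw [abs_pow, ← mul_pow]
      exact pow_le_pow_left₀ (abs_nonneg _) (pinnedChain_abs_coord_le hω hl hβ γ L x k) m

/-- `|p_k|^m ∈ L¹(μ_T)`. [folklore] -/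
theorem integrable_abs_snd_pow (L : ℕ) (k : Fin L) (m : ℕ) :
    Integrable (fun x : PhaseSpace L => |x.2 k| ^ m) ((pinnedChain ω₂ lam β γ).gibbsMeasure L T) :=
  pinnedChain_integrable_of_abs_le hω hl hβ γ L hT (((continuous_apply k).comp continuous_snd).abs.pow m)
    (C := 2 ^ m) (k := m) fun x => by
      rw [abs_pow, abs_abs, ← abs_pow]
      exact pinnedChain_abs_momentum_pow_le_all hω hl hβ γ L x k m

/-- `p_k^m ∈ L¹(μ_T)`. [folklore] -/
theorem integrable_snd_pow (L : ℕ) (k : Fin L) (m : ℕ) :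
    Integrable (fun x : PhaseSpace L => x.2 k ^ m) ((pinnedChain ω₂ lam β γ).gibbsMeasure L T) :=
  pinnedChain_integrable_of_abs_le hω hl hβ γ L hT (((continuous_apply k).comp continuous_snd).pow m)
    (C := 2 ^ m) (k := m) fun x => pinnedChain_abs_momentum_pow_le_all hω hl hβ γ L x k m

/-! ### (M1) `L`-uniform one-site moments -/

/-- **Uniform even position moments.** `∫ q_k^{2n} dμ_T ≤ κ_{2n}` for EVERY length `L` and site `k`, with the one-site
ratio `κ_{2n} = ∫ a^{2n} e^{-U(a)/T} da / ∫ e^{-U/T}` (depends on `ω₂, lam, T, n` only). [folklore] -/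
theorem exists_integral_fst_even_pow_le (n : ℕ) : ∃ C : ℝ, 0 ≤ C ∧ ∀ (L : ℕ) (k : Fin L),
    ∫ x, x.1 k ^ (2 * n) ∂((pinnedChain ω₂ lam β γ).gibbsMeasure L T) ≤ C :=
  ⟨((∫⁻ a, ENNReal.ofReal (a ^ (2 * n)) * ENNReal.ofReal (Real.exp (-(pinnedChain ω₂ lam β γ).U a / T))) /
      ∫⁻ a, ENNReal.ofReal (Real.exp (-(pinnedChain ω₂ lam β γ).U a / T))).toReal, ENNReal.toReal_nonneg,
    fun L k => integral_gibbsMeasure_le_of_density hω hl hβ γ hT L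
      (pinnedChain_integral_coord_pow_mul_gibbsDensity_le hω hl hβ γ hT L k n)⟩

/-- **Gaussian even momentum moments.** `∫ p_k^{2n} dμ_T ≤ (2n)! T^n` for every `L`, `k`. [folklore] -/
theorem integral_snd_even_pow_le (L : ℕ) (k : Fin L) (n : ℕ) :
    ∫ x, x.2 k ^ (2 * n) ∂((pinnedChain ω₂ lam β γ).gibbsMeasure L T) ≤ ((2 * n).factorial : ℝ) * T ^ n :=
  integral_gibbsMeasure_le_of_density hω hl hβ γ hT L (pinnedChain_integral_momentum_even_pow_le hω hl hβ γ L hT k n)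

/-- **Uniform absolute position moments.** For every `m` there is `C = C(ω₂, lam, T, m)` with `∫ |q_k|^m dμ_T ≤ C`
for every `L`, `k` (`|y|^m ≤ 1 + y^{2m}`). [folklore] -/
theorem exists_integral_abs_fst_pow_le (m : ℕ) : ∃ C : ℝ, 0 ≤ C ∧ ∀ (L : ℕ) (k : Fin L),
    ∫ x, |x.1 k| ^ m ∂((pinnedChain ω₂ lam β γ).gibbsMeasure L T) ≤ C := by
  obtain ⟨C, hC0, hC⟩ := exists_integral_fst_even_pow_le hω hl hβ γ hT m
  refine ⟨1 + C, by linarith, fun L k => ?_⟩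
  haveI := pinnedChain_isProbabilityMeasure_gibbsMeasure hω hl hβ γ L hT
  have h1 := integrable_fst_pow hω hl hβ γ hT L k (2 * m)
  calc ∫ x, |x.1 k| ^ m ∂((pinnedChain ω₂ lam β γ).gibbsMeasure L T)
      ≤ ∫ x, (1 + x.1 k ^ (2 * m)) ∂((pinnedChain ω₂ lam β γ).gibbsMeasure L T) :=
        integral_mono (integrable_abs_fst_pow hω hl hβ γ hT L k m) ((integrable_const 1).add h1)
          fun x => abs_pow_le_one_add_pow (by omega) _
    _ = 1 + ∫ x, x.1 k ^ (2 * m) ∂((pinnedChain ω₂ lam β γ).gibbsMeasure L T) := by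
        rw [integral_add (integrable_const _) h1]; simp
    _ ≤ 1 + C := by linarith [hC L k]

/-- **Uniform absolute momentum moments.** `∫ |p_k|^m dμ_T ≤ 1 + (2m)! T^m` for every `L`, `k`. [folklore] -/
theorem integral_abs_snd_pow_le (L : ℕ) (k : Fin L) (m : ℕ) :
    ∫ x, |x.2 k| ^ m ∂((pinnedChain ω₂ lam β γ).gibbsMeasure L T) ≤ 1 + ((2 * m).factorial : ℝ) * T ^ m := by
  haveI := pinnedChain_isProbabilityMeasure_gibbsMeasure hω hl hβ γ L hT
  have h1 := integrable_snd_pow hω hl hβ γ hT L k (2 * m)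
  calc ∫ x, |x.2 k| ^ m ∂((pinnedChain ω₂ lam β γ).gibbsMeasure L T)
      ≤ ∫ x, (1 + x.2 k ^ (2 * m)) ∂((pinnedChain ω₂ lam β γ).gibbsMeasure L T) :=
        integral_mono (integrable_abs_snd_pow hω hl hβ γ hT L k m) ((integrable_const 1).add h1)
          fun x => abs_pow_le_one_add_pow (by omega) _
    _ = 1 + ∫ x, x.2 k ^ (2 * m) ∂((pinnedChain ω₂ lam β γ).gibbsMeasure L T) := by
        rw [integral_add (integrable_const _) h1]; simp
    _ ≤ _ := by linarith [integral_snd_even_pow_le hω hl hβ γ hT L k m]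

/-! ### (M3) Gaussian recursion in one momentum with a `p_b`-independent weight -/

/-- **Gaussian recursion with a `p_b`-independent weight.** If `g` does not depend on the momentum `p_b` and
`g p_b^k, g p_b^{k+1}, g p_b^{k+2} ∈ L¹(μ_T)`, then `∫ g p_b^{k+2} dμ_T = T(k+1) ∫ g p_b^k dμ_T` (integration by parts
in `p_b`: `p_b ρ = −T ∂_{p_b} ρ`, `∂_{p_b}(g p_b^{k+1}) = (k+1) g p_b^k`; under `μ_T`, `p_b ~ N(0,T)` independently of the
other coordinates). No regularity of `g` is needed. [folklore] -/
theorem integral_indep_mul_snd_pow_add_two (L : ℕ) (b : Fin L) {g : PhaseSpace L → ℝ}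
    (hind : ∀ (x : PhaseSpace L) (t : ℝ), g (x.1, Function.update x.2 b t) = g x) (k : ℕ)
    (h0 : Integrable (fun x => g x * x.2 b ^ k) ((pinnedChain ω₂ lam β γ).gibbsMeasure L T))
    (h1 : Integrable (fun x => g x * x.2 b ^ (k + 1)) ((pinnedChain ω₂ lam β γ).gibbsMeasure L T))
    (h2 : Integrable (fun x => g x * x.2 b ^ (k + 2)) ((pinnedChain ω₂ lam β γ).gibbsMeasure L T)) :
    ∫ x, g x * x.2 b ^ (k + 2) ∂((pinnedChain ω₂ lam β γ).gibbsMeasure L T) =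
      T * (k + 1) * ∫ x, g x * x.2 b ^ k ∂((pinnedChain ω₂ lam β γ).gibbsMeasure L T) := by
  set P := pinnedChain ω₂ lam β γ with hP
  rw [P.integral_gibbsMeasure, P.integral_gibbsMeasure (fun x => g x * x.2 b ^ k)]
  have i0 := (integrable_gibbsMeasure_iff hω hl hβ γ hT L _).1 h0
  have i1 := (integrable_gibbsMeasure_iff hω hl hβ γ hT L _).1 h1
  have i2 := (integrable_gibbsMeasure_iff hω hl hβ γ hT L _).1 h2
  have e := integral_mul_eq_neg_of_hasLineDerivAt_of_integrable
    (F := fun x : PhaseSpace L => g x * x.2 b ^ (k + 1))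
    (F' := fun x : PhaseSpace L => ((k + 1 : ℕ) : ℝ) * (g x * x.2 b ^ k))
    (g := P.gibbsDensity L T) (g' := fun x => -(x.2 b / T) * P.gibbsDensity L T x)
    (v := ((0, Pi.single b 1) : PhaseSpace L)) ?_ ?_ i1 (fun x => ?_)
    (fun x => P.hasLineDerivAt_gibbsDensity (P.hasLineDerivAt_hamiltonian_unitP L x b))
  · have lhs : ∫ x, g x * x.2 b ^ (k + 1) * (-(x.2 b / T) * P.gibbsDensity L T x) =
        -T⁻¹ * ∫ x, g x * x.2 b ^ (k + 2) * P.gibbsDensity L T x := by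
      rw [← integral_const_mul]
      exact integral_congr_ae (ae_of_all _ fun x => by ring)
    have rhs : ∫ x, ((k + 1 : ℕ) : ℝ) * (g x * x.2 b ^ k) * P.gibbsDensity L T x =
        ((k : ℝ) + 1) * ∫ x, g x * x.2 b ^ k * P.gibbsDensity L T x := by
      rw [← integral_const_mul]
      exact integral_congr_ae (ae_of_all _ fun x => by push_cast; ring)
    rw [lhs, rhs] at e
    have hTne : T ≠ 0 := hT.ne'
    have e2 : T⁻¹ * ∫ x, g x * x.2 b ^ (k + 2) * P.gibbsDensity L T x =
        ((k : ℝ) + 1) * ∫ x, g x * x.2 b ^ k * P.gibbsDensity L T x := by linarith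
    have e3 : ∫ x, g x * x.2 b ^ (k + 2) * P.gibbsDensity L T x =
        T * (((k : ℝ) + 1) * ∫ x, g x * x.2 b ^ k * P.gibbsDensity L T x) := by
      rw [← e2, ← mul_assoc, mul_inv_cancel₀ hTne, one_mul]
    rw [e3]
    ring
  · exact (i0.const_mul (((k + 1 : ℕ) : ℝ))).congr (ae_of_all _ fun x => by ring)
  · exact (i2.const_mul (-T⁻¹)).congr (ae_of_all _ fun x => by simp only; ring)
  · unfold HasLineDerivAt
    have h : (fun t : ℝ => (fun z : PhaseSpace L => g z * z.2 b ^ (k + 1))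
        (x + t • ((0, Pi.single b 1) : PhaseSpace L))) = fun t => g x * (x.2 b + t) ^ (k + 1) := by
      funext t
      have h1 : x + t • ((0, Pi.single b 1) : PhaseSpace L) = (x.1, Function.update x.2 b (x.2 b + t)) := by
        rw [show x + t • ((0, Pi.single b 1) : PhaseSpace L) =
            ((x + t • ((0, Pi.single b 1) : PhaseSpace L)).1, (x + t • ((0, Pi.single b 1) : PhaseSpace L)).2)
            from rfl, add_smul_unitP_fst, add_smul_unitP_snd, add_smul_single_eq_update]
      simp only [h1, hind, Function.update_self]
    rw [h]
    have h1 : HasDerivAt (fun t : ℝ => x.2 b + t) 1 0 := (hasDerivAt_id' (0 : ℝ)).const_add _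
    refine ((h1.pow (k + 1)).const_mul (g x)).congr_deriv ?_
    simp only [Nat.add_sub_cancel, add_zero, mul_one]
    push_cast
    ring

/-- `∫ g p_b² dμ_T = T ∫ g dμ_T` for `g` independent of `p_b` with `g, g p_b, g p_b² ∈ L¹(μ_T)`. [folklore] -/
theorem integral_indep_mul_snd_sq (L : ℕ) (b : Fin L) {g : PhaseSpace L → ℝ}
    (hind : ∀ (x : PhaseSpace L) (t : ℝ), g (x.1, Function.update x.2 b t) = g x)
    (h0 : Integrable g ((pinnedChain ω₂ lam β γ).gibbsMeasure L T))
    (h1 : Integrable (fun x => g x * x.2 b) ((pinnedChain ω₂ lam β γ).gibbsMeasure L T))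
    (h2 : Integrable (fun x => g x * x.2 b ^ 2) ((pinnedChain ω₂ lam β γ).gibbsMeasure L T)) :
    ∫ x, g x * x.2 b ^ 2 ∂((pinnedChain ω₂ lam β γ).gibbsMeasure L T) =
      T * ∫ x, g x ∂((pinnedChain ω₂ lam β γ).gibbsMeasure L T) := by
  have h := integral_indep_mul_snd_pow_add_two hω hl hβ γ hT L b hind 0 (by simpa using h0) (by simpa using h1) h2
  simpa using h

/-- `∫ g p_b⁴ dμ_T = 3T² ∫ g dμ_T` for `g` independent of `p_b` with `g p_b^m ∈ L¹(μ_T)`, `m ≤ 4`. [folklore] -/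
theorem integral_indep_mul_snd_pow_four (L : ℕ) (b : Fin L) {g : PhaseSpace L → ℝ}
    (hind : ∀ (x : PhaseSpace L) (t : ℝ), g (x.1, Function.update x.2 b t) = g x)
    (hI : ∀ m : ℕ, m ≤ 4 → Integrable (fun x => g x * x.2 b ^ m) ((pinnedChain ω₂ lam β γ).gibbsMeasure L T)) :
    ∫ x, g x * x.2 b ^ 4 ∂((pinnedChain ω₂ lam β γ).gibbsMeasure L T) =
      3 * T ^ 2 * ∫ x, g x ∂((pinnedChain ω₂ lam β γ).gibbsMeasure L T) := by
  have h4 := integral_indep_mul_snd_pow_add_two hω hl hβ γ hT L b hind 2 (hI 2 (by norm_num)) (hI 3 (by norm_num))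
    (hI 4 le_rfl)
  have h2 := integral_indep_mul_snd_pow_add_two hω hl hβ γ hT L b hind 0 (hI 0 (by norm_num)) (hI 1 (by norm_num))
    (hI 2 (by norm_num))
  simp only [Nat.cast_ofNat, Nat.cast_zero, zero_add, mul_one, pow_zero] at h4 h2
  rw [h4, h2]
  ring

/-- **Self-contained form of (M3)** for a continuous weight of polynomial growth in the energy: if `|g| ≤ C(1+H)^n` and `g`
does not depend on `p_b`, then `∫ g p_b² dμ_T = T ∫ g dμ_T` and `∫ g p_b⁴ dμ_T = 3T² ∫ g dμ_T` (all integrability is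
automatic). [folklore] -/
theorem integral_indep_mul_snd_sq_of_abs_le (L : ℕ) (b : Fin L) {g : PhaseSpace L → ℝ} (hg : Continuous g) {C : ℝ} {n : ℕ}
    (hle : ∀ x, |g x| ≤ C * (1 + (pinnedChain ω₂ lam β γ).hamiltonian L x) ^ n)
    (hind : ∀ (x : PhaseSpace L) (t : ℝ), g (x.1, Function.update x.2 b t) = g x) :
    ∫ x, g x * x.2 b ^ 2 ∂((pinnedChain ω₂ lam β γ).gibbsMeasure L T) =
        T * ∫ x, g x ∂((pinnedChain ω₂ lam β γ).gibbsMeasure L T) ∧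
      ∫ x, g x * x.2 b ^ 4 ∂((pinnedChain ω₂ lam β γ).gibbsMeasure L T) =
        3 * T ^ 2 * ∫ x, g x ∂((pinnedChain ω₂ lam β γ).gibbsMeasure L T) := by
  have hI := integrable_mul_snd_pow_of_abs_le hω hl hβ γ hT L hg hle b
  exact ⟨integral_indep_mul_snd_sq hω hl hβ γ hT L b hind (by simpa using hI 0) (by simpa using hI 1) (hI 2),
    integral_indep_mul_snd_pow_four hω hl hβ γ hT L b hind fun m _ => hI m⟩

/-- **Equipartition**: `∫ p_b² dμ_T = T`. [folklore] -/
theorem integral_snd_sq (L : ℕ) (b : Fin L) :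
    ∫ x, x.2 b ^ 2 ∂((pinnedChain ω₂ lam β γ).gibbsMeasure L T) = T := by
  haveI := pinnedChain_isProbabilityMeasure_gibbsMeasure hω hl hβ γ L hT
  have h := integral_indep_mul_snd_sq hω hl hβ γ hT L b (g := fun _ => (1 : ℝ)) (fun _ _ => rfl)
    (integrable_const _) (by simpa using integrable_snd_pow hω hl hβ γ hT L b 1)
    (by simpa using integrable_snd_pow hω hl hβ γ hT L b 2)
  simpa using h

/-- **Gaussian fourth moment**: `∫ p_b⁴ dμ_T = 3T²`. [folklore] -/
theorem integral_snd_pow_four (L : ℕ) (b : Fin L) :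
    ∫ x, x.2 b ^ 4 ∂((pinnedChain ω₂ lam β γ).gibbsMeasure L T) = 3 * T ^ 2 := by
  haveI := pinnedChain_isProbabilityMeasure_gibbsMeasure hω hl hβ γ L hT
  have h := integral_indep_mul_snd_pow_four hω hl hβ γ hT L b (g := fun _ => (1 : ℝ)) (fun _ _ => rfl)
    (fun m _ => by simpa using integrable_snd_pow hω hl hβ γ hT L b m)
  simpa using h

/-- **Independence of two momenta**: `∫ p_{b'}² p_b² dμ_T = T²` for `b ≠ b'`. [folklore] -/
theorem integral_snd_sq_mul_snd_sq (L : ℕ) {b b' : Fin L} (hbb' : b ≠ b') :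
    ∫ x, x.2 b' ^ 2 * x.2 b ^ 2 ∂((pinnedChain ω₂ lam β γ).gibbsMeasure L T) = T ^ 2 := by
  have hind : ∀ (x : PhaseSpace L) (t : ℝ),
      (fun z : PhaseSpace L => z.2 b' ^ 2) (x.1, Function.update x.2 b t) = (fun z : PhaseSpace L => z.2 b' ^ 2) x :=
    fun x t => by simp [Function.update_of_ne hbb'.symm]
  have hle : ∀ x : PhaseSpace L, |x.2 b' ^ 2| ≤ 2 ^ 2 * (1 + (pinnedChain ω₂ lam β γ).hamiltonian L x) ^ 2 :=
    fun x => pinnedChain_abs_momentum_pow_le_all hω hl hβ γ L x b' 2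
  have hI := integrable_mul_snd_pow_of_abs_le hω hl hβ γ hT L (g := fun z : PhaseSpace L => z.2 b' ^ 2)
    (by fun_prop) hle b
  rw [integral_indep_mul_snd_sq hω hl hβ γ hT L b hind (by simpa using hI 0) (by simpa using hI 1) (hI 2),
    integral_snd_sq hω hl hβ γ hT L b']
  ring

end Gibbs

/-! ## Registered helpers (notation-free restatements) -/

/-- Registered helper `helper_thomsonMomentsOneSite` (W4/M1) of stub B `stub_bulkAbelGKPositivity`, line `abel-storage-decay`, crux
stmt-AtomisticToContinuum-11977: `L`-uniform even one-site moments, `∫ q_k^{2n} dμ_T ≤ C` and `∫ p_k^{2n} dμ_T ≤ C` for every length `L`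
and site `k` (`exists_integral_fst_even_pow_le`, `integral_snd_even_pow_le`). [folklore] -/
theorem helper_thomsonMomentsOneSite : ∀ (ω₂ lam β γ T : ℝ), 0 < ω₂ → 0 < lam → 0 < β → 0 < T → ∀ (n : ℕ), ∃ C : ℝ, 0 ≤ C ∧ ∀ (L : ℕ) (k : Fin L), MeasureTheory.Integrable (fun x : Literature.MathematicalPhysics.KineticTheory.HeatConduction.PhaseSpace L => x.1 k ^ (2 * n)) ((Literature.MathematicalPhysics.KineticTheory.HeatConduction.pinnedChain ω₂ lam β γ).gibbsMeasure L T) ∧ MeasureTheory.integral ((Literature.MathematicalPhysics.KineticTheory.HeatConduction.pinnedChain ω₂ lam β γ).gibbsMeasure L T) (fun x => x.1 k ^ (2 * n)) ≤ C ∧ MeasureTheory.Integrable (fun x : Literature.MathematicalPhysics.KineticTheory.HeatConduction.PhaseSpace L => x.2 k ^ (2 * n)) ((Literature.MathematicalPhysics.KineticTheory.HeatConduction.pinnedChain ω₂ lam β γ).gibbsMeasure L T) ∧ MeasureTheory.integral ((Literature.MathematicalPhysics.KineticTheory.HeatConduction.pinnedChain ω₂ lam β γ).gibbsMeasure L T)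 (fun x => x.2 k ^ (2 * n)) ≤ C := by
  intro ω₂ lam β γ T hω hl hβ hT n
  obtain ⟨C, hC0, hC⟩ := exists_integral_fst_even_pow_le hω hl.le hβ.le γ hT n
  refine ⟨max C (((2 * n).factorial : ℝ) * T ^ n), le_max_of_le_left hC0, fun L k =>
    ⟨integrable_fst_pow hω hl.le hβ.le γ hT L k _, (hC L k).trans (le_max_left _ _),
      integrable_snd_pow hω hl.le hβ.le γ hT L k _, (integral_snd_even_pow_le hω hl.le hβ.le γ hT L k n).trans (le_max_right _ _)⟩⟩

/-- Registered helper `helper_thomsonMomentsGaussianRecursion` (W4/M3): Gaussian recursion in one momentum with a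
`p_b`-independent weight, `∫ g p_b^{k+2} dμ_T = T(k+1) ∫ g p_b^k dμ_T` (`integral_indep_mul_snd_pow_add_two`). [folklore] -/
theorem helper_thomsonMomentsGaussianRecursion : ∀ (ω₂ lam β γ T : ℝ), 0 < ω₂ → 0 ≤ lam → 0 ≤ β → 0 < T → ∀ (L : ℕ) (b : Fin L) (g : Literature.MathematicalPhysics.KineticTheory.HeatConduction.PhaseSpace L → ℝ), (∀ (x : Literature.MathematicalPhysics.KineticTheory.HeatConduction.PhaseSpace L) (t : ℝ), g (x.1, Function.update x.2 b t) = g x) → ∀ (k : ℕ), MeasureTheory.Integrable (fun x => g x * x.2 b ^ k) ((Literature.MathematicalPhysics.KineticTheory.HeatConduction.pinnedChain ω₂ lam β γ).gibbsMeasure L T) → MeasureTheory.Integrable (fun x => g x * x.2 b ^ (k + 1)) ((Literature.MathematicalPhysics.KineticTheory.HeatConduction.pinnedChain ω₂ lam β γ).gibbsMeasure L T) → MeasureTheory.Integrable (fun x => g x * x.2 b ^ (k + 2)) ((Literature.MathematicalPhysics.KineticTheory.HeatConduction.pinnedChain ω₂ lam β γ).gibbsMeasure L T) → MeasureTheory.integral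 ((Literature.MathematicalPhysics.KineticTheory.HeatConduction.pinnedChain ω₂ lam β γ).gibbsMeasure L T) (fun x => g x * x.2 b ^ (k + 2)) = T * (k + 1) * MeasureTheory.integral ((Literature.MathematicalPhysics.KineticTheory.HeatConduction.pinnedChain ω₂ lam β γ).gibbsMeasure L T) (fun x => g x * x.2 b ^ k) :=
  fun _ _ _ γ _ hω hl hβ hT L b _ hind k h0 h1 h2 => integral_indep_mul_snd_pow_add_two hω hl hβ γ hT L b hind k h0 h1 h2

end Summit.AtomisticToContinuum.FouriersLaw.Theorems.NoisyFourier.ThomsonWitness.Moments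

end
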